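import Literature.Algebra.Homology.RepExtGroupCohomologyDelta
import Literature.Algebra.Homology.RepBarResolutionAugmentation
import Mathlib.RepresentationTheory.Homological.GroupCohomology.Functoriality
import HarnessLib

/-!
# Degree `0` of `Extⁿ_{Rep k G}(k, A) ≃+ Hⁿ(G, A)`: `E_A 0 (mk₀ a)` is the invariant vector `a(1)`

Topic `Algebra/Homology`; namespace `Literature.Algebra.Homology.RepExt`.  Theorems only; no
definition, no named fact, no instance, no `sorry`.  Sequel of `RepExtGroupCohomologyClasses` (explicit
classes of the dictionary `extTrivialAddEquivResolutionHomology : Extⁿ(k, A) ≃+ Hⁿ(Hom(P•, A))`),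
`RepExtGroupCohomologyDelta` (`resolutionIso_hom_eq`) and `RepBarResolutionAugmentation`
(`ε_bar (single x (single 1 1)) = 1`).

The dictionary `E_A n := extTrivialAddEquivGroupCohomology A n : Ext (Rep.trivial k G k) A n ≃+ Hⁿ(G, A)`
(standard resolution + the tree's `ResolutionComparison.resolutionIso`) is normalised in degree `0`:
for a morphism `a : k ⟶ A` of representations,

* `extTrivialAddEquivResolutionHomology_zero_mk₀`: at the resolution level `E_res P A 0 (mk₀ a)` is
  the class of the `0`-cocycle `ε_P ≫ a ∈ Hom(P₀, A)`;
* `resolutionIso_inv_homologyπ`, `inhomogeneousCochainsIso_inv_f_apply`,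
  `iCocycles_resolutionCocycle_apply`: bookkeeping through `resolutionIso⁻¹`
  (`Hom(P•, A) → Hom(bar•, A) ≅ C•(G, A)`, `ProjectiveResolution.homotopyEquiv_inv_π`);
* **`H0Iso_hom_extTrivialAddEquivGroupCohomology_mk₀`**:
  `((H0Iso A).hom (E_A 0 (mk₀ a))).1 = a.hom 1` — under Mathlib's `H⁰(G, A) ≅ Aᴳ` the class
  `E_A 0 (mk₀ a)` is the invariant vector `a(1)`; `…_zero` (any class, via `Ext.addEquiv₀`) and the
  injectivity statement `extTrivialAddEquivGroupCohomology_zero_eq_iff` used for dimension shifting.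

Written for Route A of crux `stmt-BirchSwinnertonDyer-19295` (cell `bsd-schneider-ideate`, seat
door-c4 gen 15): this is item (U0) of FINDING-door-c4-g14 §7, the base case of the change-of-group
compatibility of the dictionary (sequel `RepExtGroupCohomologyRestriction`).
HONEST FRAMING: homological algebra only; no arithmetic statement is touched.

## References
* K. S. Brown, *Cohomology of Groups*, GTM 87 (1982), III §1 (`H⁰(G, M) = Mᴳ = Hom_{ℤG}(ℤ, M)`).
  [Brown1982CohomologyGroups]
* C. A. Weibel, *An introduction to homological algebra* (1994), §2.7, Theorem 2.7.6, §6.1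
  (Definition 6.1.2). [Weibel1994]
-/

noncomputable section

universe u

namespace Literature.Algebra.Homology

namespace RepExt

open CategoryTheory CategoryTheory.Limits CategoryTheory.Abelian

variable {k G : Type u} [CommRing k] [Group G]

/-! ## §1 Degree `0` at the resolution level: `E_res P A 0 (mk₀ a) = [ε_P ≫ a]` -/

section Resolution

variable (P : ProjectiveResolution (Rep.trivial k G k)) (A : Rep.{u} k G)

/-- `ε_P ≫ a` is a `0`-cocycle of `Hom(P•, A)` (`d₁₀ ≫ ε = 0`). [cite: Weibel1994, §2.7] -/
theorem linearYonedaObj_d_aug_comp (a : Rep.trivial k G k ⟶ A) :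
    (P.complex.linearYonedaObj k A).d 0 1 (aug P ≫ a : P.complex.X 0 ⟶ A) = 0 := by
  rw [ResolutionComparison.linearYonedaObj_d_apply, ← Category.assoc, d_comp_aug, zero_comp]
  rfl

/-- A `0`-cocycle of `Hom(P•, A)` over `ε_P ≫ a` exists. [cite: Weibel1994, §2.7] -/
theorem exists_iCycles_eq_aug_comp (a : Rep.trivial k G k ⟶ A) :
    ∃ cyc : (P.complex.linearYonedaObj k A).cycles 0,
      (P.complex.linearYonedaObj k A).iCycles 0 cyc = (aug P ≫ a : P.complex.X 0 ⟶ A) :=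
  ResolutionComparison.exists_cycles_of_d_eq_zero _ 0 _ (linearYonedaObj_d_aug_comp P A a)

/-- **Degree `0` on morphisms, resolution level**: under `Ext⁰(k, A) ≃+ H⁰(Hom(P•, A))` the class
`mk₀ a` of a morphism `a : k ⟶ A` is the class of the `0`-cocycle `ε_P ≫ a`.
[cite: Weibel1994, Theorem 2.7.6][cite: Brown1982CohomologyGroups, III §1] -/
theorem extTrivialAddEquivResolutionHomology_zero_mk₀ (a : Rep.trivial k G k ⟶ A)
    (cyc : (P.complex.linearYonedaObj k A).cycles 0)
    (h : (P.complex.linearYonedaObj k A).iCycles 0 cyc = (aug P ≫ a : P.complex.X 0 ⟶ A)) :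
    extTrivialAddEquivResolutionHomology P A 0 (Ext.mk₀ a) =
      (P.complex.linearYonedaObj k A).homologyπ 0 cyc := by
  haveI := epi_aug P
  have h' : (P.complex.linearYonedaObj k A).iCycles 0 cyc =
      (P.complex.pOpcycles 0 ≫ ((LeftResolution.isoOpcyclesZero P.complex (aug P) (d_comp_aug P)
        (exact_aug P)).hom ≫ a) : P.complex.X 0 ⟶ A) := by
    rw [h, ← Category.assoc, LeftResolution.pOpcycles_isoOpcyclesZero_hom]
  have hE := extTrivialAddEquivResolutionHomology_symm_homologyπ_zero P A _ cyc h'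
  rw [Ext.mk₀_comp_mk₀, Iso.inv_hom_id_assoc] at hE
  rw [← hE, AddEquiv.apply_symm_apply]

end Resolution

/-! ## §2 Through `resolutionIso⁻¹`: `Hom(P•, A) → Hom(bar•, A) ≅ C•(G, A)` -/

section Comparison

variable (P : ProjectiveResolution (Rep.trivial k G k)) (A : Rep.{u} k G)

/-- **`resolutionIso⁻¹` on classes of cocycles**: `(resolutionIso P A n)⁻¹ [z] = π [ι⁻¹ (e⁻¹)^* z]`
with `e : P• ≃ bar•` the homotopy equivalence and `ι : C•(G, A) ≅ Hom(bar•, A)`.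
[cite: Brown1982CohomologyGroups, III §1] -/
theorem resolutionIso_inv_homologyπ (n : ℕ) (cyc : (P.complex.linearYonedaObj k A).cycles n) :
    (ResolutionComparison.resolutionIso P A n).inv ((P.complex.linearYonedaObj k A).homologyπ n cyc) =
      groupCohomology.π A n
        (HomologicalComplex.cyclesMap (groupCohomology.inhomogeneousCochainsIso A).inv n
          (HomologicalComplex.cyclesMap
            (ResolutionComparison.precomp (ResolutionComparison.toBarHomotopyEquiv P).inv A) n cyc)) := by
  change HomologicalComplex.homologyMap (groupCohomology.inhomogeneousCochainsIso A).inv n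
      (HomologicalComplex.homologyMap
        (ResolutionComparison.precomp (ResolutionComparison.toBarHomotopyEquiv P).inv A) n
        ((P.complex.linearYonedaObj k A).homologyπ n cyc)) = _
  rw [ResolutionComparison.homologyMap_homologyπ, ResolutionComparison.homologyMap_homologyπ]
  rfl

/-- The comparison `bar• → P•` (inverse of the homotopy equivalence) is compatible with the
augmentations in degree `0`: `e⁻¹₀ ≫ ε_P = ε_bar` (Mathlib `homotopyEquiv_inv_π`).
[cite: Brown1982CohomologyGroups, I (7.5)] -/
theorem toBarHomotopyEquiv_inv_f_zero_comp_aug :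
    (ResolutionComparison.toBarHomotopyEquiv P).inv.f 0 ≫ aug P = (Rep.barResolution k G).π.f 0 := by
  have h := ProjectiveResolution.homotopyEquiv_inv_π P (Rep.barResolution k G)
  have h0 := HomologicalComplex.congr_hom h 0
  rw [HomologicalComplex.comp_f] at h0
  exact h0

omit P in
/-- **Components of `ι⁻¹ : Hom(bar•, A) ≅ C•(G, A)`**: evaluation on the generators
`single x (single 1 1)` of `barₙ = free k G (Gⁿ)` (Mathlib `Rep.freeLiftLEquiv`).
[cite: Brown1982CohomologyGroups, III §1] -/
theorem inhomogeneousCochainsIso_inv_f_apply (n : ℕ) (g : (Rep.barComplex k G).X n ⟶ A)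
    (x : Fin n → G) :
    ((groupCohomology.inhomogeneousCochainsIso A).inv.f n g : (Fin n → G) → A) x =
      g.hom (Finsupp.single x (MonoidAlgebra.single (1 : G) (1 : k))) := by
  simp only [groupCohomology.inhomogeneousCochainsIso, HomologicalComplex.Hom.isoOfComponents_inv_f,
    Iso.symm_inv]
  rfl

/-- **The cocycle `ι⁻¹ (e⁻¹)^* (ε_P ≫ a)` is the constant `0`-cochain `a(1)`** (`e⁻¹₀ ≫ ε_P = ε_bar`
and `ε_bar (single x (single 1 1)) = 1`). [cite: Brown1982CohomologyGroups, III §1] -/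
theorem iCocycles_resolutionCocycle_apply (a : Rep.trivial k G k ⟶ A)
    (cyc : (P.complex.linearYonedaObj k A).cycles 0)
    (h : (P.complex.linearYonedaObj k A).iCycles 0 cyc = (aug P ≫ a : P.complex.X 0 ⟶ A))
    (x : Fin 0 → G) :
    (groupCohomology.iCocycles A 0
        (HomologicalComplex.cyclesMap (groupCohomology.inhomogeneousCochainsIso A).inv 0
          (HomologicalComplex.cyclesMap
            (ResolutionComparison.precomp (ResolutionComparison.toBarHomotopyEquiv P).inv A) 0 cyc)) :
        (Fin 0 → G) → A) x =
      a.hom (1 : k) := by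
  change (((groupCohomology.inhomogeneousCochains A).iCycles 0) _ : (Fin 0 → G) → A) x = _
  rw [ResolutionComparison.iCycles_cyclesMap, ResolutionComparison.iCycles_cyclesMap, h,
    inhomogeneousCochainsIso_inv_f_apply]
  change ((ResolutionComparison.toBarHomotopyEquiv P).inv.f 0 ≫ aug P ≫ a).hom
      (Finsupp.single x (MonoidAlgebra.single (1 : G) (1 : k))) = _
  rw [← Category.assoc, Rep.hom_comp, Representation.IntertwiningMap.comp_apply,
    toBarHomotopyEquiv_inv_f_zero_comp_aug]
  exact congrArg a.hom (barResolution_π_f_zero_single k G x)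

end Comparison

/-! ## §3 `((H0Iso A).hom (E_A 0 (mk₀ a))).1 = a(1)` -/

section DegreeZero

variable (A : Rep.{u} k G)

/-- Unfolding: `E_A n x = (resolutionIso std A n)⁻¹ (E_res std A n x)`. [cite: Brown1982CohomologyGroups, III §1] -/
theorem extTrivialAddEquivGroupCohomology_apply (n : ℕ) (x : Ext (Rep.trivial k G k) A n) :
    extTrivialAddEquivGroupCohomology A n x =
      (ResolutionComparison.resolutionIso (Rep.standardResolution k G) A n).inv
        (extTrivialAddEquivResolutionHomology (Rep.standardResolution k G) A n x) :=
  rfl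

/-- `H⁰` through `cocyclesIso₀`: `((H0Iso A).hom (π z)).1 = (ι₀ z)(∗)` — the value of the
`0`-cochain at the unique point of `G⁰`. [cite: Weibel1994, §6.1 (Definition 6.1.2)] -/
theorem H0Iso_hom_π_coe (z : groupCohomology.cocycles A 0) :
    ((groupCohomology.H0Iso A).hom (groupCohomology.π A 0 z)).1 =
      (groupCohomology.iCocycles A 0 z : (Fin 0 → G) → A) default := by
  rw [groupCohomology.π_comp_H0Iso_hom_apply]
  have h := groupCohomology.cocyclesIso₀_hom_comp_f_apply A z
  rw [groupCohomology.shortComplexH0_f] at h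
  change ((groupCohomology.cocyclesIso₀ A).hom z).1 = _ at h
  rw [h]
  simp only [groupCohomology.cochainsIso₀, LinearEquiv.toModuleIso_hom]
  rfl

/-- **Degree `0` normalisation of the dictionary**: for a morphism of representations `a : k ⟶ A`,
the class `E_A 0 (mk₀ a) ∈ H⁰(G, A)` corresponds under Mathlib's `H0Iso : H⁰(G, A) ≅ Aᴳ` to the
invariant vector `a(1)`. [cite: Brown1982CohomologyGroups, III §1][cite: Weibel1994, Definition 6.1.2] -/
theorem H0Iso_hom_extTrivialAddEquivGroupCohomology_mk₀ (a : Rep.trivial k G k ⟶ A) :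
    ((groupCohomology.H0Iso A).hom (extTrivialAddEquivGroupCohomology A 0 (Ext.mk₀ a))).1 =
      a.hom (1 : k) := by
  obtain ⟨cyc, hcyc⟩ := exists_iCycles_eq_aug_comp (Rep.standardResolution k G) A a
  rw [extTrivialAddEquivGroupCohomology_apply,
    extTrivialAddEquivResolutionHomology_zero_mk₀ (Rep.standardResolution k G) A a cyc hcyc,
    resolutionIso_inv_homologyπ, H0Iso_hom_π_coe,
    iCocycles_resolutionCocycle_apply (Rep.standardResolution k G) A a cyc hcyc]

/-- The same for an arbitrary class `x ∈ Ext⁰(k, A)` (`x = mk₀ (addEquiv₀ x)`).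
[cite: Brown1982CohomologyGroups, III §1] -/
theorem H0Iso_hom_extTrivialAddEquivGroupCohomology_zero (x : Ext (Rep.trivial k G k) A 0) :
    ((groupCohomology.H0Iso A).hom (extTrivialAddEquivGroupCohomology A 0 x)).1 =
      (Ext.addEquiv₀ x).hom (1 : k) := by
  conv_lhs => rw [← Ext.mk₀_addEquiv₀_apply x]
  exact H0Iso_hom_extTrivialAddEquivGroupCohomology_mk₀ A (Ext.addEquiv₀ x)

/-- Two classes of `H⁰(G, A)` with the same invariant vector are equal (`H0Iso` is an isomorphism).
[cite: Weibel1994, Definition 6.1.2] -/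
theorem groupCohomology_zero_ext {y y' : groupCohomology A 0}
    (h : ((groupCohomology.H0Iso A).hom y).1 = ((groupCohomology.H0Iso A).hom y').1) : y = y' :=
  (groupCohomology.H0Iso A).toLinearEquiv.injective (Subtype.ext h)

/-- A morphism out of the trivial representation `k` is determined by its value at `1`.
[cite: Brown1982CohomologyGroups, III §1] -/
theorem hom_trivial_ext {a a' : Rep.trivial k G k ⟶ A} (h : a.hom (1 : k) = a'.hom (1 : k)) : a = a' := by
  refine Rep.hom_ext (Representation.IntertwiningMap.ext (LinearMap.ext_ring ?_))
  exact h

/-- **Degree `0`, criterion**: `E_A 0 (mk₀ a) = y ↔ ((H0Iso A).hom y).1 = a(1)`.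
[cite: Brown1982CohomologyGroups, III §1] -/
theorem extTrivialAddEquivGroupCohomology_mk₀_eq_iff (a : Rep.trivial k G k ⟶ A)
    (y : groupCohomology A 0) :
    extTrivialAddEquivGroupCohomology A 0 (Ext.mk₀ a) = y ↔
      ((groupCohomology.H0Iso A).hom y).1 = a.hom (1 : k) := by
  constructor
  · rintro rfl
    exact H0Iso_hom_extTrivialAddEquivGroupCohomology_mk₀ A a
  · intro h
    exact groupCohomology_zero_ext A
      ((H0Iso_hom_extTrivialAddEquivGroupCohomology_mk₀ A a).trans h.symm)

end DegreeZero

end RepExt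

end Literature.Algebra.Homology
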